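import Literature.Geometry.Manifold.VectorSpaceGlobalFlow
import Literature.Topology.FourManifolds.RegularInterval
import Literature.Topology.FourManifolds.MMSWModelBoundaryRegular
import Summits.SmoothPoincare4.SmoothPoincare4.Theorems.DottedCircleRasmussenDcrGapStubFriendsH2HF3

/-!
# Helper `helper_friendsCarrier_Tk_collarFlow` of stub `helper_friendsCarrier_Tk` (line `mk_friends`, crux `DcrGap`)
(item stmt-SmoothPoincare4-16128, route route-SmoothPoincare4-DottedCircleRasmussen)

**The unit-speed collar flow of the model boundary `M_k = ∂D_k` in `ℝ⁴`.**  Piece (1) of the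
relative open trace `T_k` of the model dotted handlebody (`helper_friendsCarrier_Tk`): the collar
coordinate of `M_k` in `ℝ⁴`, replacing the radial coordinate `t • a` (`a ∈ S³`) of the `k = 0`
template (`OpenTrace.lean`).  Milnor, *Morse theory* (1963), proof of Thm. 3.1: a smooth vector
field `X` with `X(G) = 1` on the band `G⁻¹[1 - δ, 1 + δ]` of a level `G = 1` carrying no critical
point has a flow `θ` with THE CLOCK `G(θ(t, y)) = G(y) + t` as long as both values lie in the
band; Milnor, *h-cobordism* (1965), Thm. 3.4: `(a, s) ↦ θ(s, a)` is then a diffeomorphism of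
`M × (-δ, δ)` onto the open band, with inverse `y ↦ (θ(1 - G y, y), G y - 1)` (the "drop" onto the
level, and the clock).

Here `G = G_k` is the level function of the model (`MMSW.levelFun`), whose level `1` (with the
guard `|z - c_j|² ≥ 1`, strict on `M_k`) is the model boundary `M_k` (`MMSW.modelBoundary`) and
is regular (`MMSW.fderiv_levelFun_ne_zero`, indeed `∇G_k ≠ 0` on `{G_k ≥ 19/20}` by
`MMSW.gradSq_pos`).  The field is `W = χ · ∇G_k / |∇G_k|²` with `χ = φ_δ(G_k)` a plateau cutoff
(`= 1` on `[1 - δ, 1 + δ]`, supported in `(1 - 2δ, 1 + 2δ)`, `δ = 1/100`) made to vanish near the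
poles `z = c_j`; it is smooth and compactly supported on `ℝ⁴`, so it has a smooth complete flow
(`Literature.Geometry.Manifold.exists_contDiff_globalFlow`, Lee Thm. 9.16), and along the orbit of
a point of the band `B = {|z - c_j|² > 1/2, 1 - δ < G_k < 1 + δ}` the clock holds by the
unit-speed propagation lemma of the tree (`UnitSpeed.eq_add_of_deriv_eq_one`, run forwards and
backwards).

* `helper_friendsCarrier_Tk_collarFlow` — the packaged statement (registered helper): a smooth
  flow `θ` on `ℝ⁴` (group law) and `δ ∈ (0, 1)` such that for `y ∈ B` and every time `t` with
  `G_k y + t ∈ (1 - δ, 1 + δ)`: `θ(t, y)` satisfies the guard `> 1/2` and `G_k(θ(t, y)) = G_k y + t`;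
  the drop `θ(1 - G_k y, y)` lies on `M_k`; and for `a ∈ M_k`, `|s| < δ`:
  `θ(s, a) ∈ D_k ↔ s ≤ 0`, `θ(s, a) ∈ M_k ↔ s = 0`.

Everything is proved; no definitions, no named facts, no `sorry`.

## References

* J. Milnor, *Morse theory*, Ann. of Math. Studies 51 (1963), Thm. 3.1 and its proof. [Milnor1963]
* J. Milnor, *Lectures on the h-cobordism theorem* (1965), Thm. 3.4. [MilnorHCobordism1965]
* J. M. Lee, *Introduction to Smooth Manifolds*, 2nd ed. (2012), Thm. 9.12, Thm. 9.16.
  [LeeSmoothManifolds2013]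
-/

-- the prescribed namespace `Summit.<P>.<Sub>.…` duplicates `SmoothPoincare4` (P = Sub)
set_option linter.dupNamespace false
set_option linter.style.longLine false

noncomputable section

open scoped Manifold ContDiff Topology
open Function Set Metric
open Literature.Topology.FourManifolds Literature.Topology.FourManifolds.MMSW

namespace Summit.SmoothPoincare4.SmoothPoincare4.Theorems.DcrGap.MkFriends

namespace FriendsTk

/-! ## The symmetric plateau cutoff `φ_δ` -/

/-- The symmetric plateau cutoff `φ_δ(g) = S((g - 1 + 2δ)/δ) · S((1 + 2δ - g)/δ)` is smooth
(`S` = `Real.smoothTransition`). [folklore] -/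
theorem plateau_contDiff (δ : ℝ) :
    ContDiff ℝ ∞ (fun g : ℝ => Real.smoothTransition ((g - (1 - 2 * δ)) / δ) *
      Real.smoothTransition ((1 + 2 * δ - g) / δ)) := by
  refine ContDiff.mul ?_ ?_
  · exact Real.smoothTransition.contDiff.comp ((contDiff_id.sub contDiff_const).div_const δ)
  · exact Real.smoothTransition.contDiff.comp ((contDiff_const.sub contDiff_id).div_const δ)

/-- The plateau cutoff takes values in `[0, 1]`. [folklore] -/
theorem plateau_mem_Icc (δ g : ℝ) :
    Real.smoothTransition ((g - (1 - 2 * δ)) / δ) * Real.smoothTransition ((1 + 2 * δ - g) / δ) ∈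
      Icc (0 : ℝ) 1 :=
  ⟨mul_nonneg (Real.smoothTransition.nonneg _) (Real.smoothTransition.nonneg _),
    mul_le_one₀ (Real.smoothTransition.le_one _) (Real.smoothTransition.nonneg _)
      (Real.smoothTransition.le_one _)⟩

/-- The plateau cutoff is `1` on `[1 - δ, 1 + δ]` (`δ > 0`). [folklore] -/
theorem plateau_eq_one {δ g : ℝ} (hδ : 0 < δ) (h1 : 1 - δ ≤ g) (h2 : g ≤ 1 + δ) :
    Real.smoothTransition ((g - (1 - 2 * δ)) / δ) * Real.smoothTransition ((1 + 2 * δ - g) / δ) = 1 := by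
  rw [Real.smoothTransition.one_of_one_le, Real.smoothTransition.one_of_one_le, mul_one]
  · rw [le_div_iff₀ hδ]; linarith
  · rw [le_div_iff₀ hδ]; linarith

/-- Where the plateau cutoff does not vanish, `1 - 2δ < g < 1 + 2δ` (`δ > 0`). [folklore] -/
theorem plateau_ne_zero {δ g : ℝ} (hδ : 0 < δ)
    (h : Real.smoothTransition ((g - (1 - 2 * δ)) / δ) * Real.smoothTransition ((1 + 2 * δ - g) / δ) ≠ 0) :
    1 - 2 * δ < g ∧ g < 1 + 2 * δ := by
  obtain ⟨ha, hb⟩ := mul_ne_zero_iff.1 h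
  rw [Ne, Real.smoothTransition.zero_iff_nonpos, not_le] at ha hb
  constructor
  · have := (div_pos_iff_of_pos_right hδ).1 ha; linarith
  · have := (div_pos_iff_of_pos_right hδ).1 hb; linarith

/-! ## Guard bookkeeping -/

/-- A point off the poles with `G_k ≤ 1` satisfies the guard `|z - c_j|² ≥ 1` (each hole term
contributes `1/|z - c_j|² ≤ G_k`). [folklore] -/
theorem one_le_holeTerm_of_levelFun_le_one {k : ℕ} {y : EuclideanSpace ℝ (Fin 4)}
    (hy : ∀ j, 0 < holeTerm k j y) (hG : levelFun k y ≤ 1) (j : Fin k) : 1 ≤ holeTerm k j y := by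
  have h := ((FriendsH2.levelFun_bounds hy).2.2 j).trans hG
  rwa [div_le_one (hy j)] at h

/-! ## The collar flow -/

/-- **The unit-speed collar flow of `M_k` in `ℝ⁴`** (Milnor 1963, proof of Thm. 3.1; Lee 2012,
Thm. 9.16): a smooth complete flow `θ` on `ℝ⁴` and `δ ∈ (0, 1)` such that on the band
`B = {|z - c_j|² > 1/2, G_k ∈ (1 - δ, 1 + δ)}` the clock `G_k(θ(t, y)) = G_k(y) + t` holds for all
times keeping the value in `(1 - δ, 1 + δ)`, the guard `> 1/2` being preserved; the drop
`θ(1 - G_k y, y)` of a band point lies on `M_k`; and the flow-out of `M_k` meets `D_k` exactly for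
nonpositive times. [cite: Milnor1963, proof of Thm. 3.1] -/
theorem exists_collarFlow (k : ℕ) :
    ∃ (θ : ℝ × EuclideanSpace ℝ (Fin 4) → EuclideanSpace ℝ (Fin 4)) (δ : ℝ), 0 < δ ∧ δ < 1 ∧
      ContDiff ℝ ∞ θ ∧ (∀ x, θ (0, x) = x) ∧ (∀ t s x, θ (t, θ (s, x)) = θ (t + s, x)) ∧
      (∀ y : EuclideanSpace ℝ (Fin 4), (∀ j, (1 : ℝ) / 2 < holeTerm k j y) →
        levelFun k y ∈ Ioo (1 - δ) (1 + δ) →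
        (∀ t : ℝ, levelFun k y + t ∈ Ioo (1 - δ) (1 + δ) →
          (∀ j, (1 : ℝ) / 2 < holeTerm k j (θ (t, y))) ∧ levelFun k (θ (t, y)) = levelFun k y + t) ∧
        θ (1 - levelFun k y, y) ∈ modelBoundary k) ∧
      (∀ a ∈ modelBoundary k, ∀ s ∈ Ioo (-δ) δ,
        (θ (s, a) ∈ modelHandlebody k ↔ s ≤ 0) ∧ (θ (s, a) ∈ modelBoundary k ↔ s = 0)) := by
  -- constants
  have hR40 : (40 : ℝ) ≤ 40 * ((k : ℝ) + 1) := by nlinarith [(k.cast_nonneg : (0 : ℝ) ≤ k)]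
  set R : ℝ := 40 * ((k : ℝ) + 1) with hRdef
  set δ : ℝ := 1 / 100 with hδ
  have hδ0 : 0 < δ := by norm_num [hδ]
  -- the cutoff, the half-gradient, the field
  set φ : ℝ → ℝ := fun g => Real.smoothTransition ((g - (1 - 2 * δ)) / δ) *
    Real.smoothTransition ((1 + 2 * δ - g) / δ) with hφ
  set a : EuclideanSpace ℝ (Fin 4) → ℝ := fun y => y 0 / (40 * ((k : ℝ) + 1)) ^ 2 -
    ∑ j : Fin k, (y 0 - 4 * (((j : ℕ) : ℝ) + 1)) / holeTerm k j y ^ 2 with ha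
  set b : EuclideanSpace ℝ (Fin 4) → ℝ := fun y => y 1 / (40 * ((k : ℝ) + 1)) ^ 2 -
    ∑ j : Fin k, y 1 / holeTerm k j y ^ 2 with hb
  set gradG : EuclideanSpace ℝ (Fin 4) → EuclideanSpace ℝ (Fin 4) :=
    fun y => !₂[a y, b y, y 2, y 3] with hgradG
  set S : EuclideanSpace ℝ (Fin 4) → ℝ := fun y => a y ^ 2 + b y ^ 2 + y 2 ^ 2 + y 3 ^ 2 with hS
  set χ : EuclideanSpace ℝ (Fin 4) → ℝ :=
    fun y => if ∀ j : Fin k, (1 : ℝ) / 4 < holeTerm k j y then φ (levelFun k y) else 0 with hχ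
  set W : EuclideanSpace ℝ (Fin 4) → EuclideanSpace ℝ (Fin 4) :=
    fun y => (χ y / (2 * S y)) • gradG y with hW
  -- `dG(gradG) = 2 S`
  have hfd : ∀ y, (∀ j, holeTerm k j y ≠ 0) → fderiv ℝ (levelFun k) y (gradG y) = 2 * S y := by
    intro y hy
    rw [fderiv_levelFun_apply hy]
    simp only [hgradG, hS, ha, hb]
    simp
    ring
  -- `S > 0` on `{G ≥ 1 - 2δ}`
  have hSpos : ∀ y, (∀ j, holeTerm k j y ≠ 0) → 1 - 2 * δ ≤ levelFun k y → 0 < S y := by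
    intro y hy hG
    by_cases hg : 19 / 20 ≤ levelFun k y - ((y 2) ^ 2 + (y 3) ^ 2)
    · have h := gradSq_pos hy hg
      simp only [hS, ha, hb]
      nlinarith [sq_nonneg (y 2), sq_nonneg (y 3)]
    · push Not at hg
      have h1 : 0 < (y 2) ^ 2 + (y 3) ^ 2 := by
        simp only [hδ] at hG
        linarith
      simp only [hS]
      nlinarith [sq_nonneg (a y), sq_nonneg (b y)]
  -- the cutoff `χ`
  have hχ01 : ∀ y, 0 ≤ χ y ∧ χ y ≤ 1 := by
    intro y
    simp only [hχ]
    split_ifs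
    · exact ⟨(plateau_mem_Icc δ _).1, (plateau_mem_Icc δ _).2⟩
    · exact ⟨le_rfl, zero_le_one⟩
  have hχne : ∀ y, χ y ≠ 0 → (∀ j, (1 : ℝ) / 4 < holeTerm k j y) ∧
      1 - 2 * δ < levelFun k y ∧ levelFun k y < 1 + 2 * δ := by
    intro y h
    simp only [hχ] at h
    split_ifs at h with h4
    · exact ⟨h4, plateau_ne_zero hδ0 h⟩
    · exact absurd rfl h
  have hχeq : ∀ y, (∀ j, (1 : ℝ) / 4 < holeTerm k j y) → χ y = φ (levelFun k y) := fun y h => by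
    simp only [hχ, if_pos h]
  have hpos4 : ∀ y, (∀ j, (1 : ℝ) / 4 < holeTerm k j y) → ∀ j, 0 < holeTerm k j y :=
    fun y h j => lt_trans (by norm_num) (h j)
  have hne4 : ∀ y, (∀ j, (1 : ℝ) / 4 < holeTerm k j y) → ∀ j, holeTerm k j y ≠ 0 :=
    fun y h j => (hpos4 y h j).ne'
  -- where `χ ≠ 0`: `S > 0`, `gradG ≠ 0`, `W ≠ 0`, `dG(W) = χ`
  have hSχ : ∀ y, χ y ≠ 0 → 0 < S y := fun y h =>
    hSpos y (hne4 y (hχne y h).1) (hχne y h).2.1.le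
  have hWχ : ∀ y, W y = 0 → χ y = 0 := by
    intro y hWy
    by_contra h
    have hS0 := hSχ y h
    have hg0 : gradG y = 0 := (smul_eq_zero.1 hWy).resolve_left (by
      exact div_ne_zero h (mul_ne_zero two_ne_zero hS0.ne'))
    have : S y = 0 := by
      have h0 : a y = 0 := by simpa [hgradG] using congr_fun (congrArg (fun v : EuclideanSpace ℝ (Fin 4) => (v : Fin 4 → ℝ)) hg0) 0
      have h1 : b y = 0 := by simpa [hgradG] using congr_fun (congrArg (fun v : EuclideanSpace ℝ (Fin 4) => (v : Fin 4 → ℝ)) hg0) 1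
      have h2 : y 2 = 0 := by simpa [hgradG] using congr_fun (congrArg (fun v : EuclideanSpace ℝ (Fin 4) => (v : Fin 4 → ℝ)) hg0) 2
      have h3 : y 3 = 0 := by simpa [hgradG] using congr_fun (congrArg (fun v : EuclideanSpace ℝ (Fin 4) => (v : Fin 4 → ℝ)) hg0) 3
      simp only [hS, h0, h1, h2, h3]
      norm_num
    exact hS0.ne' this
  have hdGW : ∀ y, χ y ≠ 0 → fderiv ℝ (levelFun k) y (W y) = χ y := by
    intro y h
    have hS0 := hSχ y h
    simp only [hW, map_smul, smul_eq_mul]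
    rw [hfd y (hne4 y (hχne y h).1)]
    field_simp
  -- smoothness of the field
  have hgrad : ∀ y, (∀ j, holeTerm k j y ≠ 0) → ContDiffAt ℝ ∞ gradG y := by
    intro y hy
    rw [contDiffAt_euclidean]
    intro i
    fin_cases i
    · simpa [hgradG] using contDiffAt_gRe hy
    · simpa [hgradG] using contDiffAt_gIm hy
    · simp [hgradG]; fun_prop
    · simp [hgradG]; fun_prop
  have hScd : ∀ y, (∀ j, holeTerm k j y ≠ 0) → ContDiffAt ℝ ∞ S y := by
    intro y hy
    simp only [hS]
    have h2 : ContDiffAt ℝ ∞ (fun y : EuclideanSpace ℝ (Fin 4) => y 2) y :=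
      (contDiffAt_euclidean.1 contDiffAt_id) 2
    have h3 : ContDiffAt ℝ ∞ (fun y : EuclideanSpace ℝ (Fin 4) => y 3) y :=
      (contDiffAt_euclidean.1 contDiffAt_id) 3
    exact ((((contDiffAt_gRe hy).pow 2).add ((contDiffAt_gIm hy).pow 2)).add (h2.pow 2)).add (h3.pow 2)
  have hWs : ContDiff ℝ ∞ W := by
    rw [contDiff_iff_contDiffAt]
    intro y
    by_cases hy4 : ∀ j : Fin k, (1 : ℝ) / 4 < holeTerm k j y
    · have hy0 : ∀ j, holeTerm k j y ≠ 0 := hne4 y hy4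
      by_cases hG : levelFun k y < 1 - 2 * δ
      · -- below the support: `W = 0` near `y`
        have hopen : IsOpen ({y' : EuclideanSpace ℝ (Fin 4) | ∀ j : Fin k, (1 : ℝ) / 4 < holeTerm k j y'} ∩
            levelFun k ⁻¹' Iio (1 - 2 * δ)) :=
          ((continuousOn_levelFun (r := k) (by norm_num : (0 : ℝ) < 1 / 4)).mono
            (fun y' (hy' : ∀ j : Fin k, (1 : ℝ) / 4 < holeTerm k j y') j => le_of_lt (hy' j))).isOpen_inter_preimage
            (isOpen_guard (1 / 4)) isOpen_Iio
        have hev : W =ᶠ[𝓝 y] fun _ => 0 := by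
          filter_upwards [hopen.mem_nhds ⟨hy4, hG⟩] with y' hy'
          have hχ0 : χ y' = 0 := by
            by_contra h
            have := (hχne y' h).2.1
            exact absurd hy'.2 (not_lt.2 this.le)
          simp only [hW, hχ0, zero_div, zero_smul]
        exact (contDiffAt_const (c := (0 : EuclideanSpace ℝ (Fin 4)))).congr_of_eventuallyEq hev
      · push Not at hG
        have hS0 : 0 < S y := hSpos y hy0 hG
        have hev : W =ᶠ[𝓝 y] fun y' => (φ (levelFun k y') / (2 * S y')) • gradG y' := by
          filter_upwards [(isOpen_guard (1 / 4)).mem_nhds hy4] with y' hy'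
          simp only [hW, hχeq y' hy']
        refine ContDiffAt.congr_of_eventuallyEq ?_ hev
        have hq : ContDiffAt ℝ ∞ (fun y' => φ (levelFun k y') / (2 * S y')) y := by
          exact ContDiffAt.div (f := fun y' => φ (levelFun k y')) (g := fun y' => 2 * S y')
            ((plateau_contDiff δ).contDiffAt.comp y (contDiffAt_levelFun hy0))
            (contDiffAt_const.mul (hScd y hy0)) (mul_ne_zero two_ne_zero hS0.ne')
        exact hq.smul (hgrad y hy0)
    · push Not at hy4
      obtain ⟨j, hj⟩ := hy4
      have hev : W =ᶠ[𝓝 y] fun _ => 0 := by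
        have hopen : IsOpen {y' : EuclideanSpace ℝ (Fin 4) | holeTerm k j y' < 1 / 2} :=
          isOpen_lt (continuous_holeTerm j) continuous_const
        filter_upwards [hopen.mem_nhds (show holeTerm k j y < 1 / 2 by linarith)] with y' hy'
        have hχ0 : χ y' = 0 := by
          by_contra h
          obtain ⟨h4, -, hlt⟩ := hχne y' h
          have h2 := (FriendsH2.levelFun_bounds (hpos4 y' h4)).2.2 j
          have h3 : 2 < 1 / holeTerm k j y' := by
            rw [lt_one_div two_pos (hpos4 y' h4 j)]; exact hy'
          simp only [hδ] at hlt
          linarith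
        simp only [hW, hχ0, zero_div, zero_smul]
      exact (contDiffAt_const (c := (0 : EuclideanSpace ℝ (Fin 4)))).congr_of_eventuallyEq hev
  -- compact support: `‖y‖ ≤ 2R` where `W ≠ 0`
  have hWK : ∀ y, y ∉ closedBall (0 : EuclideanSpace ℝ (Fin 4)) (2 * R) → W y = 0 := by
    intro y hy
    by_contra h
    have hχ0 : χ y ≠ 0 := fun h0 => h (by simp only [hW, h0, zero_div, zero_smul])
    obtain ⟨h4, -, hlt⟩ := hχne y hχ0
    have h1 := FriendsH2.norm_sq_le_levelFun (hpos4 y h4)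
    rw [← hRdef] at h1
    have hR1 : (40 : ℝ) ≤ R := hR40
    have h2 : ‖y‖ ^ 2 ≤ (2 * R) ^ 2 := by
      have : levelFun k y * (R ^ 2 + 1) ≤ (1 + 2 * δ) * (R ^ 2 + 1) :=
        mul_le_mul_of_nonneg_right hlt.le (by positivity)
      simp only [hδ] at this
      nlinarith
    have h3 : ‖y‖ ≤ 2 * R := (pow_le_pow_iff_left₀ (norm_nonneg y) (by positivity) two_ne_zero).1 h2
    exact hy (mem_closedBall_zero_iff.2 h3)
  -- the flow
  obtain ⟨θ, hθs, h0, hadd, hint, hfix⟩ := Literature.Geometry.Manifold.exists_contDiff_globalFlow hWs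
    (isCompact_closedBall (0 : EuclideanSpace ℝ (Fin 4)) (2 * R)) hWK
  -- band points move with nonvanishing field for all times
  have horbit : ∀ y : EuclideanSpace ℝ (Fin 4), (∀ j, (1 : ℝ) / 2 < holeTerm k j y) →
      levelFun k y ∈ Ioo (1 - δ) (1 + δ) → ∀ t, χ (θ (t, y)) ≠ 0 := by
    intro y hy hG t
    have h4 : ∀ j, (1 : ℝ) / 4 < holeTerm k j y := fun j => lt_trans (by norm_num) (hy j)
    have hχy : χ y ≠ 0 := by
      rw [hχeq y h4, show φ (levelFun k y) = 1 from plateau_eq_one hδ0 hG.1.le hG.2.le]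
      exact one_ne_zero
    have hWy : W y ≠ 0 := fun h => hχy (hWχ y h)
    have hWt := Literature.Geometry.Manifold.vectorField_flow_ne_zero h0 hadd hfix hWy t
    exact fun h => hWt (by simp only [hW, h, zero_div, zero_smul])
  -- the clock
  have hclock : ∀ y : EuclideanSpace ℝ (Fin 4), (∀ j, (1 : ℝ) / 2 < holeTerm k j y) →
      levelFun k y ∈ Ioo (1 - δ) (1 + δ) → ∀ t : ℝ, levelFun k y + t ∈ Ioo (1 - δ) (1 + δ) →
      levelFun k (θ (t, y)) = levelFun k y + t := by
    intro y hy hG t ht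
    have hχt : ∀ s, χ (θ (s, y)) ≠ 0 := horbit y hy hG
    have h4t : ∀ s j, (1 : ℝ) / 4 < holeTerm k j (θ (s, y)) := fun s => (hχne _ (hχt s)).1
    have h0t : ∀ s j, holeTerm k j (θ (s, y)) ≠ 0 := fun s => hne4 _ (h4t s)
    -- `G` along the orbit has derivative `χ`
    have hg : ∀ s, HasDerivAt (fun s => levelFun k (θ (s, y))) (χ (θ (s, y))) s := by
      intro s
      have hGd : HasFDerivAt (levelFun k) (fderiv ℝ (levelFun k) (θ (s, y))) (θ (s, y)) :=
        ((contDiffAt_levelFun (h0t s)).differentiableAt (by simp)).hasFDerivAt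
      have h := hGd.comp_hasDerivAt s (hint y s)
      rwa [hdGW _ (hχt s)] at h
    have hband : ∀ s, (fun s => levelFun k (θ (s, y))) s ∈ Ioo (1 - δ) (1 + δ) → χ (θ (s, y)) = 1 := by
      intro s hs
      rw [hχeq _ (h4t s)]
      exact plateau_eq_one hδ0 hs.1.le hs.2.le
    have hg0 : levelFun k (θ (0, y)) = levelFun k y := by rw [h0]
    rcases le_or_gt 0 t with ht0 | ht0
    · -- forwards
      have h := UnitSpeed.eq_add_of_deriv_eq_one hg hband (t₀ := 0) (T := t)
        (by rw [hg0]; exact hG.1) (by rw [hg0]; exact ht.2) t ⟨ht0, le_rfl⟩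
      simp only [zero_add, hg0] at h
      exact h
    · -- backwards, by time reversal
      have hg' := fun u => UnitSpeed.hasDerivAt_neg_comp_sub hg 0 u
      have hband' := UnitSpeed.band_neg_comp_sub (g := fun s => levelFun k (θ (s, y))) hband 0
      have h := UnitSpeed.eq_add_of_deriv_eq_one (g := fun u => -(fun s => levelFun k (θ (s, y))) (0 - u))
        hg' hband' (t₀ := 0) (T := -t)
        (by simp only [sub_zero, hg0]; linarith [hG.2])
        (by simp only [sub_zero, hg0]; linarith [ht.1]) (-t) ⟨by linarith, le_rfl⟩
      simp only [zero_add, sub_zero, hg0, sub_neg_eq_add] at h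
      linarith
  -- conclusion
  refine ⟨θ, δ, hδ0, by norm_num [hδ], hθs, h0, hadd, fun y hy hG => ⟨fun t ht => ?_, ?_⟩, fun x hx s hs => ?_⟩
  · have hχt := horbit y hy hG t
    have h4 := (hχne _ hχt).1
    have hcl := hclock y hy hG t ht
    refine ⟨fun j => ?_, hcl⟩
    exact FriendsH2.half_lt_holeTerm_of_levelFun_lt_two (hpos4 _ h4) (by rw [hcl]; linarith [ht.2, show δ < 1 by norm_num [hδ]]) j
  · -- the drop lies on `M_k`
    have ht : levelFun k y + (1 - levelFun k y) ∈ Ioo (1 - δ) (1 + δ) := by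
      rw [add_sub_cancel]; exact ⟨by linarith, by linarith⟩
    have hχt := horbit y hy hG (1 - levelFun k y)
    have h4 := (hχne _ hχt).1
    have hcl := hclock y hy hG _ ht
    rw [add_sub_cancel] at hcl
    exact ⟨fun j => one_le_holeTerm_of_levelFun_le_one (hpos4 _ h4) hcl.le j, hcl⟩
  · -- flow-out of `M_k` versus `D_k`
    have hx2 : ∀ j, (1 : ℝ) / 2 < holeTerm k j x := fun j => lt_of_lt_of_le (by norm_num) (hx.1 j)
    have hGx : levelFun k x ∈ Ioo (1 - δ) (1 + δ) := by rw [hx.2]; exact ⟨by linarith, by linarith⟩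
    have ht : levelFun k x + s ∈ Ioo (1 - δ) (1 + δ) := by rw [hx.2]; exact ⟨by linarith [hs.1], by linarith [hs.2]⟩
    have hχt := horbit x hx2 hGx s
    have h4 := (hχne _ hχt).1
    have hcl := hclock x hx2 hGx s ht
    rw [hx.2] at hcl
    refine ⟨⟨fun h => ?_, fun h => ?_⟩, ⟨fun h => ?_, fun h => ?_⟩⟩
    · have := h.2; rw [hcl] at this; linarith
    · exact ⟨fun j => one_le_holeTerm_of_levelFun_le_one (hpos4 _ h4) (by rw [hcl]; linarith) j, by rw [hcl]; linarith⟩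
    · have := h.2; rw [hcl] at this; linarith
    · subst h
      rw [h0]; exact hx

end FriendsTk

/-- **Helper `helper_friendsCarrier_Tk_collarFlow`** (registered on the crux item; piece (1) of the
relative open trace `T_k` of stub `helper_friendsCarrier_Tk`): the unit-speed collar flow of the
model boundary `M_k` in `ℝ⁴` — a smooth complete flow `θ` of `ℝ⁴` (group law) and `δ ∈ (0, 1)`
with the clock `G_k(θ(t, y)) = G_k y + t` on the band `{|z - c_j|² > 1/2, 1 - δ < G_k < 1 + δ}`
(guard preserved), the drop `θ(1 - G_k y, y) ∈ M_k`, and `θ(s, a) ∈ D_k ↔ s ≤ 0`,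
`θ(s, a) ∈ M_k ↔ s = 0` for `a ∈ M_k`, `|s| < δ` (Milnor 1963, proof of Thm. 3.1; Milnor 1965,
Thm. 3.4; Lee 2012, Thm. 9.16). [cite: Milnor1963, proof of Thm. 3.1] -/
theorem helper_friendsCarrier_Tk_collarFlow : ∀ k : ℕ, ∃ (θ : ℝ × EuclideanSpace ℝ (Fin 4) → EuclideanSpace ℝ (Fin 4)) (δ : ℝ), 0 < δ ∧ δ < 1 ∧ ContDiff ℝ ((⊤ : ℕ∞) : WithTop ℕ∞) θ ∧ (∀ x, θ (0, x) = x) ∧ (∀ t s x, θ (t, θ (s, x)) = θ (t + s, x)) ∧ (∀ y : EuclideanSpace ℝ (Fin 4), (∀ j, (1 : ℝ) / 2 < Literature.Topology.FourManifolds.MMSW.holeTerm k j y) → Literature.Topology.FourManifolds.MMSW.levelFun k y ∈ Set.Ioo (1 - δ) (1 + δ) → (∀ t : ℝ, Literature.Topology.FourManifolds.MMSW.levelFun k y + t ∈ Set.Ioo (1 - δ) (1 + δ) → (∀ j, (1 : ℝ) / 2 < Literature.Topology.FourManifolds.MMSW.holeTerm k j (θ (t, y))) ∧ Literature.Topology.FourManifolds.MMSW.levelFun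 k (θ (t, y)) = Literature.Topology.FourManifolds.MMSW.levelFun k y + t) ∧ θ (1 - Literature.Topology.FourManifolds.MMSW.levelFun k y, y) ∈ Literature.Topology.FourManifolds.MMSW.modelBoundary k) ∧ (∀ a ∈ Literature.Topology.FourManifolds.MMSW.modelBoundary k, ∀ s ∈ Set.Ioo (-δ) δ, (θ (s, a) ∈ Literature.Topology.FourManifolds.MMSW.modelHandlebody k ↔ s ≤ 0) ∧ (θ (s, a) ∈ Literature.Topology.FourManifolds.MMSW.modelBoundary k ↔ s = 0)) :=
  FriendsTk.exists_collarFlow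

end Summit.SmoothPoincare4.SmoothPoincare4.Theorems.DcrGap.MkFriends

end
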